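import Summits.CriticalPhenomena.PercolationContinuityZ3.Theorems.PercNearOneGluingAdditiveGluingGluedPairThm1
import Summits.CriticalPhenomena.PercolationContinuityZ3.Theorems.PercNearOneGluingAdditiveGluingGluedPairSets
import HarnessLib

/-! # Crux `PercNearOneGluing.AdditiveGluing` (stmt-CriticalPhenomena-4576): three relays — the glued-pair exchange (T-d)
# implies the additive inequality (reduction, nondegenerate case)

Support file (`--supports stmt-CriticalPhenomena-4576`, lead prim-png-lead-4576).  No definitions, no named facts, no sorries.
Notation (events of `μ = prodBernoulli w`): relays `a₁ a₂ a₃`, target `b`, observer `o`; `W = {a₁,a₃}`;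
`N₂ = {a₂↮a₁}∩{a₂↮a₃}`, `O_W = {o↔a₁}∪{o↔a₃}`, `O₂ = {o↔a₂}`, `OA = O_W ∪ O₂`, `B_W = {a₁↔b}∪{a₃↔b}`, `B₂ = {a₂↔b}`,
`P' = ({o↔a₁}∩{a₃↔b}) ∪ ({o↔a₃}∩{a₁↔b})` (o joined to one relay of `W`, `b` to the other), `PivO = μ({o↮b} ∩ P')`,
`Q' = ({a₂↔a₁}∩{a₃↔b}) ∪ ({a₂↔a₃}∩{a₁↔b})`, `Piv2 = μ({a₂↮b} ∩ Q')`, `π_x = μ(a₁↔b, a₃↮b)`, `R_W = μ(B_Wᶜ ∩ OAᶜ)`,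
`R₂' = μ({a₂↮b} ∩ Q'ᶜ ∩ OAᶜ)`, `α = μ(N₂∩O_W)`, `β = μ(N₂∩O₂)`, `slack = μ(a₃↮b) − μ(OA ∖ {o↔b})` (the additive E-form slack).

**Identities (pointwise inclusion–exclusion, `gluedPair_eq_alpha/beta`):**
  `slack = [μ(N₂∩O₂∩B₂) − μ(N₂∩O₂∩B_W)] + π_x + R_W − PivO`,
  `slack = [μ(N₂∩O_W∩B_W) − μ(N₂∩O_W∩B₂)] + (τ₂−τ₃) + Piv2 + R₂' − PivO`
(they are Kozma–Nitzan's "subtract the common event" identities for the glued graph `G/W`, written in `G`).  Hence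
`(α+β)·slack = WT + [α(π_x+R_W) + β((τ₂−τ₃)+Piv2+R₂') − (α+β)·PivO]` with `WT ≥ 0` the weighted Theorem 1 for the glued pair
(`gluedPair_weightedThm1`, landed), and **the glued-pair exchange (T-d)** (registered stub `stub_gluedPairExchangeTie_pl`)
`(α+β)·PivO ≤ α(π_x+R_W) + β((τ₂−τ₃)+Piv2+R₂')` implies `slack ≥ 0` whenever `α+β = μ(N₂ ∩ OA) > 0`
(`additiveGluing_threeRelays_eform_of_gluedPairExchange`).  [cite: KozmaNitzan2024, Theorem 1 (§3.1, pp. 7–8)]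
-/

namespace Summit.CriticalPhenomena.PercolationContinuityZ3.Theorems

open MeasureTheory Set Literature.Probability.LatticeModels Literature.Probability.Percolation

noncomputable section
open Classical

variable {n : ℕ}

/-- **Identity (Eq-α).**  `μ(a₃↮b) − μ(OA ∖ o↔b) = [μ(N₂∩(O₂∩B₂)) − μ(N₂∩(O₂∩B_W))] + π_x + R_W − PivO`
(Kozma–Nitzan's subtraction of the common event `{o ↔' w}` for the glued graph `G/W`, `W = {a₁,a₃}`, written in `G`).
[cite: KozmaNitzan2024, proof of Theorem 1 (p. 8)] -/
theorem gluedPair_eq_alpha (w : Sym2 (Fin n) → unitInterval) (o b a₁ a₂ a₃ : Fin n) :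
    (prodBernoulli w).real ((openConn a₃ b)ᶜ : Set (BondConfig (Fin n))) -
        (prodBernoulli w).real ((openConn o a₁ ∪ openConn o a₂ ∪ openConn o a₃) \ openConn o b : Set (BondConfig (Fin n))) =
      ((prodBernoulli w).real ((openConn a₂ a₁)ᶜ ∩ (openConn a₂ a₃)ᶜ ∩ (openConn o a₂ ∩ openConn a₂ b) : Set (BondConfig (Fin n))) -
          (prodBernoulli w).real ((openConn a₂ a₁)ᶜ ∩ (openConn a₂ a₃)ᶜ ∩ (openConn o a₂ ∩ (openConn a₁ b ∪ openConn a₃ b)) :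
            Set (BondConfig (Fin n)))) +
        (prodBernoulli w).real (openConn a₁ b ∩ (openConn a₃ b)ᶜ : Set (BondConfig (Fin n))) +
        (prodBernoulli w).real ((openConn a₁ b)ᶜ ∩ (openConn a₃ b)ᶜ ∩ (openConn o a₁ ∪ openConn o a₂ ∪ openConn o a₃)ᶜ :
          Set (BondConfig (Fin n))) -
        (prodBernoulli w).real ((openConn o b)ᶜ ∩ (openConn o a₁ ∩ openConn a₃ b ∪ openConn o a₃ ∩ openConn a₁ b) :
          Set (BondConfig (Fin n))) := by
  have hm : ∀ s : Set (BondConfig (Fin n)), MeasurableSet s := fun _ => MeasurableSet.of_discrete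
  set OA : Set (BondConfig (Fin n)) := openConn o a₁ ∪ openConn o a₂ ∪ openConn o a₃ with hOA
  set OW : Set (BondConfig (Fin n)) := openConn o a₁ ∪ openConn o a₃ with hOW
  set BW : Set (BondConfig (Fin n)) := openConn a₁ b ∪ openConn a₃ b with hBW
  set P' : Set (BondConfig (Fin n)) := openConn o a₁ ∩ openConn a₃ b ∪ openConn o a₃ ∩ openConn a₁ b with hP'
  set Eg : Set (BondConfig (Fin n)) := openConn o b ∪ P' with hEg
  set N2O2 : Set (BondConfig (Fin n)) := (openConn a₂ a₁)ᶜ ∩ (openConn a₂ a₃)ᶜ ∩ openConn o a₂ with hN2O2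
  -- f1: `μ(a₃bᶜ) = μ(BWᶜ) + π_x`
  have f1 : (prodBernoulli w).real ((openConn a₃ b)ᶜ : Set (BondConfig (Fin n))) =
      (prodBernoulli w).real BWᶜ + (prodBernoulli w).real (openConn a₁ b ∩ (openConn a₃ b)ᶜ : Set (BondConfig (Fin n))) := by
    have := measureReal_union (μ := prodBernoulli w) (gluedPair_compl3_disj b a₁ a₃) (hm _)
    rw [← gluedPair_compl3_eq b a₁ a₃] at this
    exact this
  -- f2: `μ(OA ∖ ob) = μ(OA ∖ Eg) + PivO`
  have f2 : (prodBernoulli w).real (OA \ openConn o b) = (prodBernoulli w).real (OA \ Eg) + (prodBernoulli w).real ((openConn o b)ᶜ ∩ P') := by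
    rw [show OA \ openConn o b = (OA \ Eg) ∪ ((openConn o b)ᶜ ∩ P') from gluedPair_OAob_eq o b a₁ a₂ a₃]
    exact measureReal_union (μ := prodBernoulli w) (gluedPair_OAob_disj o b a₁ a₂ a₃) (hm _)
  -- f3, f4, f5: splitting `OA` and `BWᶜ`
  have f3 : (prodBernoulli w).real (OA ∩ Eg) + (prodBernoulli w).real (OA \ Eg) = (prodBernoulli w).real OA :=
    measureReal_inter_add_sdiff (μ := prodBernoulli w) (s := OA) (hm Eg)
  have f4 : (prodBernoulli w).real (OA ∩ BW) + (prodBernoulli w).real (OA \ BW) = (prodBernoulli w).real OA :=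
    measureReal_inter_add_sdiff (μ := prodBernoulli w) (s := OA) (hm BW)
  have f5 : (prodBernoulli w).real (BWᶜ ∩ OA) + (prodBernoulli w).real (BWᶜ \ OA) = (prodBernoulli w).real BWᶜ :=
    measureReal_inter_add_sdiff (μ := prodBernoulli w) (s := BWᶜ) (hm OA)
  have f5a : BWᶜ ∩ OA = OA \ BW := by rw [Set.inter_comm, Set.sdiff_eq]
  have f5b : BWᶜ \ OA = (openConn a₁ b)ᶜ ∩ (openConn a₃ b)ᶜ ∩ OAᶜ := gluedPair_RW_eq o b a₁ a₂ a₃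
  rw [f5a, f5b] at f5
  -- f6: the KN difference `μ(OA ∩ Eg) − μ(OA ∩ BW)`
  have hOAsplit : OA = OW ∪ (openConn o a₂ ∩ OWᶜ) := gluedPair_OA_eq o a₁ a₂ a₃
  have hOAdisj : Disjoint OW (openConn o a₂ ∩ OWᶜ) := gluedPair_OA_disj o a₁ a₂ a₃
  have f6a : (prodBernoulli w).real (OA ∩ Eg) = (prodBernoulli w).real (OW ∩ Eg) + (prodBernoulli w).real (openConn o a₂ ∩ OWᶜ ∩ Eg) := by
    rw [hOAsplit, Set.union_inter_distrib_right]
    exact measureReal_union (μ := prodBernoulli w) (hOAdisj.mono Set.inter_subset_left Set.inter_subset_left) (hm _)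
  have f6b : (prodBernoulli w).real (OA ∩ BW) = (prodBernoulli w).real (OW ∩ BW) + (prodBernoulli w).real (openConn o a₂ ∩ OWᶜ ∩ BW) := by
    rw [hOAsplit, Set.union_inter_distrib_right]
    exact measureReal_union (μ := prodBernoulli w) (hOAdisj.mono Set.inter_subset_left Set.inter_subset_left) (hm _)
  have f6c : OW ∩ Eg = OW ∩ BW := gluedPair_OW_E_eq o b a₁ a₃
  have f6d : openConn o a₂ ∩ OWᶜ = N2O2 := gluedPair_O2_diff_OW o a₁ a₂ a₃
  have f6e : N2O2 ∩ Eg = N2O2 ∩ openConn a₂ b := gluedPair_O2N2_E_eq o b a₁ a₂ a₃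
  rw [f6c, f6d, f6e] at f6a
  rw [f6d] at f6b
  have e1 : N2O2 ∩ openConn a₂ b = (openConn a₂ a₁)ᶜ ∩ (openConn a₂ a₃)ᶜ ∩ (openConn o a₂ ∩ openConn a₂ b) := by
    rw [hN2O2, Set.inter_assoc]
  have e2 : N2O2 ∩ BW = (openConn a₂ a₁)ᶜ ∩ (openConn a₂ a₃)ᶜ ∩ (openConn o a₂ ∩ BW) := by
    rw [hN2O2, Set.inter_assoc]
  rw [e1] at f6a
  rw [e2] at f6b
  linarith

/-- **Identity (Eq-β).**  `μ(a₃↮b) − μ(OA ∖ o↔b) = [μ(N₂∩(O_W∩B_W)) − μ(N₂∩(O_W∩B₂))] + (τ₂−τ₃) + Piv2 + R₂' − PivO`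
(subtraction of the common event `{o ↔' a₂}` for `G/W`). [cite: KozmaNitzan2024, proof of Theorem 1 (p. 8)] -/
theorem gluedPair_eq_beta (w : Sym2 (Fin n) → unitInterval) (o b a₁ a₂ a₃ : Fin n) :
    (prodBernoulli w).real ((openConn a₃ b)ᶜ : Set (BondConfig (Fin n))) -
        (prodBernoulli w).real ((openConn o a₁ ∪ openConn o a₂ ∪ openConn o a₃) \ openConn o b : Set (BondConfig (Fin n))) =
      ((prodBernoulli w).real ((openConn a₂ a₁)ᶜ ∩ (openConn a₂ a₃)ᶜ ∩ ((openConn o a₁ ∪ openConn o a₃) ∩ (openConn a₁ b ∪ openConn a₃ b)) :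
            Set (BondConfig (Fin n))) -
          (prodBernoulli w).real ((openConn a₂ a₁)ᶜ ∩ (openConn a₂ a₃)ᶜ ∩ ((openConn o a₁ ∪ openConn o a₃) ∩ openConn a₂ b) :
            Set (BondConfig (Fin n)))) +
        ((prodBernoulli w).real (openConn a₂ b : Set (BondConfig (Fin n))) -
          (prodBernoulli w).real (openConn a₃ b : Set (BondConfig (Fin n)))) +
        (prodBernoulli w).real ((openConn a₂ b)ᶜ ∩ (openConn a₂ a₁ ∩ openConn a₃ b ∪ openConn a₂ a₃ ∩ openConn a₁ b) :
          Set (BondConfig (Fin n))) +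
        (prodBernoulli w).real ((openConn a₂ b)ᶜ ∩ ((openConn a₂ a₁ ∪ openConn a₂ a₃) ∩ (openConn a₁ b ∪ openConn a₃ b))ᶜ ∩
          (openConn o a₁ ∪ openConn o a₂ ∪ openConn o a₃)ᶜ : Set (BondConfig (Fin n))) -
        (prodBernoulli w).real ((openConn o b)ᶜ ∩ (openConn o a₁ ∩ openConn a₃ b ∪ openConn o a₃ ∩ openConn a₁ b) :
          Set (BondConfig (Fin n))) := by
  have hm : ∀ s : Set (BondConfig (Fin n)), MeasurableSet s := fun _ => MeasurableSet.of_discrete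
  set OA : Set (BondConfig (Fin n)) := openConn o a₁ ∪ openConn o a₂ ∪ openConn o a₃ with hOA
  set OW : Set (BondConfig (Fin n)) := openConn o a₁ ∪ openConn o a₃ with hOW
  set BW : Set (BondConfig (Fin n)) := openConn a₁ b ∪ openConn a₃ b with hBW
  set P' : Set (BondConfig (Fin n)) := openConn o a₁ ∩ openConn a₃ b ∪ openConn o a₃ ∩ openConn a₁ b with hP'
  set Eg : Set (BondConfig (Fin n)) := openConn o b ∪ P' with hEg
  set Q' : Set (BondConfig (Fin n)) := openConn a₂ a₁ ∩ openConn a₃ b ∪ openConn a₂ a₃ ∩ openConn a₁ b with hQ'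
  set F2g : Set (BondConfig (Fin n)) := openConn a₂ b ∪ Q' with hF2g
  set W2 : Set (BondConfig (Fin n)) := openConn a₂ a₁ ∪ openConn a₂ a₃ with hW2
  set O2g : Set (BondConfig (Fin n)) := openConn o a₂ ∪ OW ∩ W2 with hO2g
  set N2OW : Set (BondConfig (Fin n)) := (openConn a₂ a₁)ᶜ ∩ (openConn a₂ a₃)ᶜ ∩ OW with hN2OW
  -- g1: `μ(F2g) = τ₂ + Piv2`
  have g1 : (prodBernoulli w).real F2g = (prodBernoulli w).real (openConn a₂ b : Set (BondConfig (Fin n))) + (prodBernoulli w).real ((openConn a₂ b)ᶜ ∩ Q') := by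
    rw [show F2g = openConn a₂ b ∪ ((openConn a₂ b)ᶜ ∩ Q') from gluedPair_a2glued_eq b a₁ a₂ a₃]
    exact measureReal_union (μ := prodBernoulli w) (gluedPair_a2glued_disj b a₁ a₂ a₃) (hm _)
  -- g2: complements
  have g2a : (prodBernoulli w).real F2gᶜ = 1 - (prodBernoulli w).real F2g := probReal_compl_eq_one_sub (hm _)
  have g2b : (prodBernoulli w).real ((openConn a₃ b)ᶜ : Set (BondConfig (Fin n))) = 1 - (prodBernoulli w).real (openConn a₃ b : Set (BondConfig (Fin n))) :=
    probReal_compl_eq_one_sub (hm _)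
  -- g3: `μ(F2gᶜ) = μ(OA ∖ F2g) + R₂'`
  have g3 : (prodBernoulli w).real (F2gᶜ ∩ OA) + (prodBernoulli w).real (F2gᶜ \ OA) = (prodBernoulli w).real F2gᶜ :=
    measureReal_inter_add_sdiff (μ := prodBernoulli w) (s := F2gᶜ) (hm OA)
  have g3a : F2gᶜ ∩ OA = OA \ F2g := by rw [Set.inter_comm, Set.sdiff_eq]
  have g3b : F2gᶜ \ OA = (openConn a₂ b)ᶜ ∩ (W2 ∩ BW)ᶜ ∩ OAᶜ := by
    rw [hF2g, Set.compl_union, gluedPair_Q_compl_eq b a₁ a₂ a₃, Set.sdiff_eq]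
  rw [g3a, g3b] at g3
  -- g4: splitting `OA` along `F2g` and along `Eg`
  have g4 : (prodBernoulli w).real (OA ∩ F2g) + (prodBernoulli w).real (OA \ F2g) = (prodBernoulli w).real OA :=
    measureReal_inter_add_sdiff (μ := prodBernoulli w) (s := OA) (hm F2g)
  have f3 : (prodBernoulli w).real (OA ∩ Eg) + (prodBernoulli w).real (OA \ Eg) = (prodBernoulli w).real OA :=
    measureReal_inter_add_sdiff (μ := prodBernoulli w) (s := OA) (hm Eg)
  -- f2: `μ(OA ∖ ob) = μ(OA ∖ Eg) + PivO`
  have f2 : (prodBernoulli w).real (OA \ openConn o b) = (prodBernoulli w).real (OA \ Eg) + (prodBernoulli w).real ((openConn o b)ᶜ ∩ P') := by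
    rw [show OA \ openConn o b = (OA \ Eg) ∪ ((openConn o b)ᶜ ∩ P') from gluedPair_OAob_eq o b a₁ a₂ a₃]
    exact measureReal_union (μ := prodBernoulli w) (gluedPair_OAob_disj o b a₁ a₂ a₃) (hm _)
  -- g5: the KN difference `μ(OA ∩ Eg) − μ(OA ∩ F2g)`
  have hOAsplit : OA = O2g ∪ N2OW := gluedPair_OA_eq' o a₁ a₂ a₃
  have hOAdisj : Disjoint O2g N2OW := gluedPair_OA_disj' o a₁ a₂ a₃
  have g5a : (prodBernoulli w).real (OA ∩ Eg) = (prodBernoulli w).real (O2g ∩ Eg) + (prodBernoulli w).real (N2OW ∩ Eg) := by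
    rw [hOAsplit, Set.union_inter_distrib_right]
    exact measureReal_union (μ := prodBernoulli w) (hOAdisj.mono Set.inter_subset_left Set.inter_subset_left) (hm _)
  have g5b : (prodBernoulli w).real (OA ∩ F2g) = (prodBernoulli w).real (O2g ∩ F2g) + (prodBernoulli w).real (N2OW ∩ F2g) := by
    rw [hOAsplit, Set.union_inter_distrib_right]
    exact measureReal_union (μ := prodBernoulli w) (hOAdisj.mono Set.inter_subset_left Set.inter_subset_left) (hm _)
  have g5c : O2g ∩ Eg = O2g ∩ F2g := gluedPair_O2glued_eq o b a₁ a₂ a₃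
  have g5d : N2OW ∩ Eg = N2OW ∩ BW := gluedPair_OWN2_E_eq o b a₁ a₂ a₃
  have g5e : N2OW ∩ F2g = N2OW ∩ openConn a₂ b := gluedPair_OWN2_F2_eq o b a₁ a₂ a₃
  rw [g5c, g5d] at g5a
  rw [g5e] at g5b
  have e1 : N2OW ∩ BW = (openConn a₂ a₁)ᶜ ∩ (openConn a₂ a₃)ᶜ ∩ (OW ∩ BW) := by rw [hN2OW, Set.inter_assoc]
  have e2 : N2OW ∩ openConn a₂ b = (openConn a₂ a₁)ᶜ ∩ (openConn a₂ a₃)ᶜ ∩ (OW ∩ openConn a₂ b) := by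
    rw [hN2OW, Set.inter_assoc]
  rw [e1] at g5a
  rw [e2] at g5b
  linarith

/-- **Three relays: the glued-pair exchange (T-d) implies the additive E-form (nondegenerate case).**
If `μ(N₂ ∩ OA) = α + β > 0` and `(α+β)·PivO ≤ α(π_x+R_W) + β((τ₂−τ₃)+Piv2+R₂')` (the registered stub
`stub_gluedPairExchangeTie_pl` at these parameters), then `μ(OA ∖ {o↔b}) ≤ μ(a₃↮b)`.
Proof: `(α+β)·slack = WT + gap(T-d)` by `gluedPair_eq_alpha/beta`, `WT ≥ 0` by `gluedPair_weightedThm1`.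
[cite: KozmaNitzan2024, Theorem 1 (§3.1, pp. 7–8)] -/
theorem additiveGluing_threeRelays_eform_of_gluedPairExchange (w : Sym2 (Fin n) → unitInterval) (o b a₁ a₂ a₃ : Fin n)
    (h12 : a₁ ≠ a₂) (h23 : a₂ ≠ a₃)
    (hnd : 0 < (prodBernoulli w).real ((openConn a₂ a₁)ᶜ ∩ (openConn a₂ a₃)ᶜ ∩ (openConn o a₁ ∪ openConn o a₃)) +
      (prodBernoulli w).real ((openConn a₂ a₁)ᶜ ∩ (openConn a₂ a₃)ᶜ ∩ openConn o a₂))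
    (hTd : ((prodBernoulli w).real ((openConn a₂ a₁)ᶜ ∩ (openConn a₂ a₃)ᶜ ∩ (openConn o a₁ ∪ openConn o a₃)) + (prodBernoulli w).real ((openConn a₂ a₁)ᶜ ∩ (openConn a₂ a₃)ᶜ ∩ openConn o a₂)) * (prodBernoulli w).real ((openConn o b)ᶜ ∩ (openConn o a₁ ∩ openConn a₃ b ∪ openConn o a₃ ∩ openConn a₁ b)) ≤ (prodBernoulli w).real ((openConn a₂ a₁)ᶜ ∩ (openConn a₂ a₃)ᶜ ∩ (openConn o a₁ ∪ openConn o a₃)) * ((prodBernoulli w).real (openConn a₁ b ∩ (openConn a₃ b)ᶜ) + (prodBernoulli w).real ((openConn a₁ b)ᶜ ∩ (openConn a₃ b)ᶜ ∩ (openConn o a₁ ∪ openConn o a₂ ∪ openConn o a₃)ᶜ)) + (prodBernoulli w).real ((openConn a₂ a₁)ᶜ ∩ (openConn a₂ a₃)ᶜ ∩ openConn o a₂) * (((prodBernoulli w).real (openConn a₂ b) - (prodBernoulli w).real (openConn a₃ b)) + (prodBernoulli w).real ((openConn a₂ b)ᶜ ∩ (openConn a₂ a₁ ∩ openConn a₃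 b ∪ openConn a₂ a₃ ∩ openConn a₁ b)) + (prodBernoulli w).real ((openConn a₂ b)ᶜ ∩ ((openConn a₂ a₁ ∪ openConn a₂ a₃) ∩ (openConn a₁ b ∪ openConn a₃ b))ᶜ ∩ (openConn o a₁ ∪ openConn o a₂ ∪ openConn o a₃)ᶜ))) :
    (prodBernoulli w).real ((openConn o a₁ ∪ openConn o a₂ ∪ openConn o a₃) \ openConn o b : Set (BondConfig (Fin n))) ≤
      (prodBernoulli w).real ((openConn a₃ b)ᶜ : Set (BondConfig (Fin n))) := by
  have hα := gluedPair_eq_alpha w o b a₁ a₂ a₃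
  have hβ := gluedPair_eq_beta w o b a₁ a₂ a₃
  have hWS : Disjoint ({a₁, a₃} : Finset (Fin n)) {a₂} := by
    rw [Finset.disjoint_singleton_right, Finset.mem_insert, Finset.mem_singleton, not_or]
    exact ⟨h12.symm, h23⟩
  have hWT := gluedPair_weightedThm1 w {a₁, a₃} {a₂} o b hWS
  rw [gluedPair_sep_pair_eq, gluedPair_biUnion_pair_eq o a₁ a₃, gluedPair_biUnion_pair_eq b a₁ a₃,
    gluedPair_biUnion_single_eq o a₂, gluedPair_biUnion_single_eq b a₂] at hWT
  rw [knThm2_openConn_comm b a₁, knThm2_openConn_comm b a₃, knThm2_openConn_comm b a₂] at hWT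
  set α := (prodBernoulli w).real ((openConn a₂ a₁)ᶜ ∩ (openConn a₂ a₃)ᶜ ∩ (openConn o a₁ ∪ openConn o a₃)) with hαdef
  set β := (prodBernoulli w).real ((openConn a₂ a₁)ᶜ ∩ (openConn a₂ a₃)ᶜ ∩ openConn o a₂) with hβdef
  set slack := (prodBernoulli w).real ((openConn a₃ b)ᶜ : Set (BondConfig (Fin n))) -
    (prodBernoulli w).real ((openConn o a₁ ∪ openConn o a₂ ∪ openConn o a₃) \ openConn o b : Set (BondConfig (Fin n))) with hslack
  have key : 0 ≤ (α + β) * slack := by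
    have e : (α + β) * slack = α * slack + β * slack := by ring
    rw [e]
    nlinarith [hWT, hTd, hα, hβ, measureReal_nonneg (μ := prodBernoulli w) (s := (openConn a₂ a₁)ᶜ ∩ (openConn a₂ a₃)ᶜ ∩ (openConn o a₁ ∪ openConn o a₃)),
      measureReal_nonneg (μ := prodBernoulli w) (s := (openConn a₂ a₁)ᶜ ∩ (openConn a₂ a₃)ᶜ ∩ openConn o a₂)]
  have hs : 0 ≤ slack := by
    by_contra hneg
    push Not at hneg
    have := mul_neg_of_pos_of_neg hnd hneg
    linarith
  linarith

end

end Summit.CriticalPhenomena.PercolationContinuityZ3.Theorems
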